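import Literature.Analysis.InnerProduct.RestrictedHilbertTensorSlot
import Mathlib.Topology.Algebra.RestrictedProduct.Basic
import Mathlib.Topology.Algebra.LinearMapCompletion
import Mathlib.Topology.UniformSpace.UniformApproximation

/-!
# The restricted Hilbert tensor product, III: the representation `⊗′_i ρ_i`

Topic `Analysis/InnerProduct`; continues `RestrictedHilbertTensor` (`Space 𝓔 = ⊗′_i (H_i, e_i)`, pure tensors
`tp 𝓔 x = ⊗x`, `⟪⊗x, ⊗y⟫ = ∏ ⟪x_i, y_i⟫`) and `RestrictedHilbertTensorSlot` (slot maps `slotₗ`, `slot`).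

* §4 THE RESTRICTED TENSOR PRODUCT REPRESENTATION. Local data: groups `G i` with distinguished subsets
  `B i` (any `SetLike`, subgroups for the homomorphism), unitary representations `ρ i : G i →* (H i ≃ₗᵢ[ℂ] H i)`,
  ADMISSIBLE along `e` (`Admissible 𝓔 B ρ`: `ρ_i(B_i)` fixes `e_i` for almost all `i`). Then the restricted
  product `Πʳ i, [G i, B i]` (Mathlib `RestrictedProduct`, cofinite filter) acts on restricted families
  (`gact`), isometrically on formal combinations (`preActₗᵢ`, the kernel being invariant, `kfun_gact`), hence by
  extension to the completion (`actL`, Mathlib `ContinuousLinearMap.completion`) by unitaries: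
  **`rep hρ : Πʳ i, [G i, B i] →* (Space 𝓔 ≃ₗᵢ[ℂ] Space 𝓔)`** with **`rep_tp`** `(⊗′ρ)(g)(⊗x) = ⊗ ρ_i(g_i) x_i`
  (Guichardet (1972), App. A §A.4, p. 151 [Guichardet1972]: "there exists a unique operator … `⊗T_i`, such that
  `(⊗T_i)(⊗x_i) = ⊗ T_i x_i`", stated there for `T_i = I` a.e.; here `T_i = ρ_i(g_i)` fixes `e_i` a.e., which
  is what the construction uses) and `inner_tp_rep_tp` `⟪⊗x, (⊗′ρ)(g) ⊗y⟫ = ∏ᶠ_i ⟪x_i, ρ_i(g_i) y_i⟫`.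
* §5 IDENTITIES FOR A PURE TENSOR OF UNIT VECTORS `φ = ⊗φ_i`: `norm_tp_eq_one`; fixed vectors of boxes
  (`rep_tp_eq_self_of_forall_apply_eq`, `rep_tp_eq_self_of_box`); local and finite-product matrix coefficients
  (`inner_tp_rep_mulSingle_tp`, `inner_tp_rep_tp_eq_prod`); the basic elements `ι_i(g) = RestrictedProduct.mulSingle
  B i g` act through the `i`-th slot (`rep_mulSingle_tp`, **slot intertwining** `rep_mulSingle_slot :
  (⊗′ρ)(ι_i g) ∘ V_i = V_i ∘ ρ_i(g)`, `rep_mulSingle_tp_of_smul`); **strong continuity** of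
  `g ↦ (⊗′ρ)(ι_i g) v` from local strong continuity (`continuous_rep_mulSingle`, by density of the span of pure
  tensors and `continuous_of_uniform_approx_of_continuous`).

Everything is proved (Mathlib only).

## References

* A. Guichardet, *Symmetric Hilbert spaces and related topics*, LNM 261 (1972), App. A §§A.1, A.4
  [Guichardet1972] (held, PDF pp. 85, 88).
* J. von Neumann, *On infinite direct products*, Compositio Math. 6 (1939) 1–77 [vonNeumann1939].

## Provenance

Reproduced for the tree under the LEAN-IN-TREE rule (2026-08-18) from the pub-hodgecm cell's package file
`HodgeCM/PerL34/RestrictedTensor.lean` §§4–5 (DAG-node prover #09 lineage, seat pv09-g6, gate run 27), verbatim up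
to the namespace (`HodgeCM.PerL34.RestrictedTensor` ↦ `Literature.Analysis.InnerProduct.RestrictedTensor`) and the
added docstrings, except that the four §5 lemmas stated over the package's `boxSubgroup` / `PureTensor.localCoeff` /
`PureTensor.extendOne` are replaced by their package-free forms `rep_tp_eq_self_of_box`, `inner_tp_rep_mulSingle_tp`,
`inner_tp_rep_tp_eq_prod` (same proofs, memberships unfolded into hypotheses).
-/

set_option autoImplicit false

noncomputable section

open Function Set Filter
open scoped InnerProductSpace ComplexConjugate RestrictedProduct

namespace Literature.Analysis.InnerProduct.RestrictedTensor

universe u v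

variable {ι : Type u} {H : ι → Type v} [∀ i, NormedAddCommGroup (H i)]
  [∀ i, InnerProductSpace ℂ (H i)] {𝓔 : UnitFamily H}

open RVec

/-! ## §4 The restricted-product representation `⊗′ ρ_i` -/

section action

variable {G : ι → Type*} [∀ i, Group (G i)] {Sub : ι → Type*} [∀ i, SetLike (Sub i) (G i)]
  {B : ∀ i, Sub i} {ρ : ∀ i, G i →* (H i ≃ₗᵢ[ℂ] H i)}

variable (𝓔) in
/-- Admissibility of local data `(ρ_i, B_i)` along `e`: `ρ_i(B_i)` fixes `e_i` for almost all `i`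
(so that `Πʳ [G i, B i]` acts on restricted families). [folklore] -/
def Admissible (B : ∀ i, Sub i) (ρ : ∀ i, G i →* (H i ≃ₗᵢ[ℂ] H i)) : Prop :=
  ∀ᶠ i in cofinite, ∀ b ∈ B i, ρ i b (𝓔.e i) = 𝓔.e i

variable (hρ : Admissible 𝓔 B ρ)
include hρ

/-- For `g ∈ Πʳ [G i, B i]`, `ρ_i(g_i)` fixes `e_i` for almost all `i`. [folklore] -/
theorem Admissible.eventually_apply_e (g : Πʳ i, [G i, B i]) :
    ∀ᶠ i in cofinite, ρ i (g i) (𝓔.e i) = 𝓔.e i :=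
  (g.2.and hρ).mono fun _ hi => hi.2 _ hi.1

/-- The action of `Πʳ [G i, B i]` on restricted families: `(g • x)_i = ρ_i(g_i) x_i`. [folklore] -/
def gact (g : Πʳ i, [G i, B i]) (x : RVec 𝓔) : RVec 𝓔 :=
  RVec.map (fun i => ρ i (g i)) (hρ.eventually_apply_e g) x

/-- Components of `g • x`. [folklore] -/
@[simp] theorem gact_apply (g : Πʳ i, [G i, B i]) (x : RVec 𝓔) (i : ι) :
    gact hρ g x i = ρ i (g i) (x i) := rfl

/-- The product kernel is invariant under the action (each `ρ_i(g_i)` being unitary). [folklore] -/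
theorem kfun_gact (g : Πʳ i, [G i, B i]) (x y : RVec 𝓔) :
    kfun (gact hρ g x) (gact hρ g y) = kfun x y :=
  finprod_congr fun _ => LinearIsometryEquiv.inner_map_map _ _ _

/-- The action on formal combinations (push-forward along `gact`). [folklore] -/
def preAct (g : Πʳ i, [G i, B i]) : Pre 𝓔 →ₗ[ℂ] Pre 𝓔 := Finsupp.lmapDomain ℂ ℂ (gact hρ g)

/-- Unfolding `preAct`. [folklore] -/
theorem preAct_apply (g : Πʳ i, [G i, B i]) (f : Pre 𝓔) :
    preAct hρ g f = Finsupp.mapDomain (gact hρ g) f := rfl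

omit hρ in
/-- Change of variables in the double sum of the pre-inner product under a push-forward of formal
combinations. [folklore] -/
theorem sum_sum_mapDomain (φ : RVec 𝓔 → RVec 𝓔) (f f' : Pre 𝓔) (k : RVec 𝓔 → RVec 𝓔 → ℂ) :
    ((Finsupp.mapDomain φ f).sum fun x a =>
      (Finsupp.mapDomain φ f').sum fun y b => conj a * b * k x y) =
      f.sum fun x a => f'.sum fun y b => conj a * b * k (φ x) (φ y) := by
  rw [Finsupp.sum_mapDomain_index]
  · refine Finsupp.sum_congr fun x _ => ?_
    rw [Finsupp.sum_mapDomain_index]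
    · intro y; simp
    · intro y b₁ b₂; ring
  · intro x; simp
  · intro x a₁ a₂; simp only [map_add, add_mul, Finsupp.sum_add]

/-- The action on formal combinations preserves the pre-inner product. [folklore] -/
theorem inner_preAct (g : Πʳ i, [G i, B i]) (f f' : Pre 𝓔) :
    ⟪preAct hρ g f, preAct hρ g f'⟫_ℂ = ⟪f, f'⟫_ℂ := by
  rw [inner_pre_def, inner_pre_def, preAct_apply, preAct_apply, sum_sum_mapDomain]
  exact Finsupp.sum_congr fun x _ => Finsupp.sum_congr fun y _ => by rw [kfun_gact]

/-- The action on formal combinations is isometric. [folklore] -/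
def preActₗᵢ (g : Πʳ i, [G i, B i]) : Pre 𝓔 →ₗᵢ[ℂ] Pre 𝓔 :=
  { preAct hρ g with
    norm_map' := fun f => by
      change ‖preAct hρ g f‖ = ‖f‖
      rw [norm_eq_sqrt_re_inner (𝕜 := ℂ), norm_eq_sqrt_re_inner (𝕜 := ℂ) f, inner_preAct] }

/-- Unfolding `preActₗᵢ`. [folklore] -/
@[simp] theorem preActₗᵢ_apply (g : Πʳ i, [G i, B i]) (f : Pre 𝓔) :
    preActₗᵢ hρ g f = preAct hρ g f := rfl

/-- The action of `g` on `⊗′ H`, as a continuous linear map (extension by continuity). [cite: Guichardet1972, App. A §A.4, p. 151 (PDF p. 88)] -/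
def actL (g : Πʳ i, [G i, B i]) : Space 𝓔 →L[ℂ] Space 𝓔 :=
  (preActₗᵢ hρ g).toContinuousLinearMap.completion

/-- `actL g` on the image of a formal combination. [folklore] -/
theorem actL_coe (g : Πʳ i, [G i, B i]) (f : Pre 𝓔) :
    actL hρ g (f : Space 𝓔) = ((preAct hρ g f : Pre 𝓔) : Space 𝓔) :=
  ContinuousLinearMap.completion_apply_coe _ _

/-- `g • ⊗x = ⊗ ρ_i(g_i) x_i` — the tensor product of the operators `ρ_i(g_i)` on elementary decomposable
vectors (Guichardet 1972, App. A §A.4, for `T_i = I` a.e.; here `T_i e_i = e_i` a.e.). [cite: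
Guichardet1972, App. A §A.4, p. 151 (PDF p. 88)] -/
@[simp] theorem actL_tp (g : Πʳ i, [G i, B i]) (x : RVec 𝓔) :
    actL hρ g (tp 𝓔 x) = tp 𝓔 (gact hρ g x) := by
  rw [tp, actL_coe, preAct_apply, Finsupp.mapDomain_single]; rfl

/-- `actL g` is isometric. [folklore] -/
theorem norm_actL (g : Πʳ i, [G i, B i]) (z : Space 𝓔) : ‖actL hρ g z‖ = ‖z‖ := by
  refine UniformSpace.Completion.induction_on z
    (isClosed_eq (actL hρ g).continuous.norm continuous_norm) fun f => ?_
  rw [actL_coe, UniformSpace.Completion.norm_coe, UniformSpace.Completion.norm_coe]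
  exact (preActₗᵢ hρ g).norm_map f

variable [∀ i, SubgroupClass (Sub i) (G i)]

/-- `1 • x = x`. [folklore] -/
theorem gact_one (x : RVec 𝓔) : gact hρ 1 x = x :=
  RVec.ext fun i => by simp [RestrictedProduct.one_apply]

/-- `(g h) • x = g • (h • x)`. [folklore] -/
theorem gact_mul (g h : Πʳ i, [G i, B i]) (x : RVec 𝓔) :
    gact hρ (g * h) x = gact hρ g (gact hρ h x) :=
  RVec.ext fun i => by simp [RestrictedProduct.mul_apply]

/-- `actL 1 = id`. [folklore] -/
theorem actL_one : actL hρ 1 = ContinuousLinearMap.id ℂ (Space 𝓔) :=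
  clm_ext fun x => by rw [actL_tp, gact_one]; rfl

/-- `actL (g h) = actL g ∘ actL h`. [folklore] -/
theorem actL_mul (g h : Πʳ i, [G i, B i]) : actL hρ (g * h) = (actL hρ g).comp (actL hρ h) :=
  clm_ext fun x => by simp only [ContinuousLinearMap.comp_apply, actL_tp, gact_mul]

/-- `actL g⁻¹ ∘ actL g = id`. [folklore] -/
theorem actL_inv_actL (g : Πʳ i, [G i, B i]) (z : Space 𝓔) : actL hρ g⁻¹ (actL hρ g z) = z := by
  rw [← ContinuousLinearMap.comp_apply, ← actL_mul, inv_mul_cancel, actL_one]; rfl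

/-- `actL g ∘ actL g⁻¹ = id`. [folklore] -/
theorem actL_actL_inv (g : Πʳ i, [G i, B i]) (z : Space 𝓔) : actL hρ g (actL hρ g⁻¹ z) = z := by
  rw [← ContinuousLinearMap.comp_apply, ← actL_mul, mul_inv_cancel, actL_one]; rfl

/-- The action of `g` on `⊗′ H` as a unitary (linear isometric equivalence). [folklore] -/
def repEquiv (g : Πʳ i, [G i, B i]) : Space 𝓔 ≃ₗᵢ[ℂ] Space 𝓔 :=
  { (actL hρ g).toLinearMap with
    invFun := actL hρ g⁻¹
    left_inv := actL_inv_actL hρ g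
    right_inv := actL_actL_inv hρ g
    norm_map' := norm_actL hρ g }

/-- Unfolding `repEquiv`. [folklore] -/
@[simp] theorem repEquiv_apply (g : Πʳ i, [G i, B i]) (z : Space 𝓔) :
    repEquiv hρ g z = actL hρ g z := rfl

/-- **The restricted tensor product representation** `⊗′_i ρ_i : Πʳ [G i, B i] →* U(⊗′_i H_i)`. [cite: Guichardet1972, App. A §A.4, p. 151 (PDF p. 88)] -/
def rep : (Πʳ i, [G i, B i]) →* (Space 𝓔 ≃ₗᵢ[ℂ] Space 𝓔) where
  toFun := repEquiv hρ
  map_one' := LinearIsometryEquiv.ext fun z => by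
    rw [repEquiv_apply, actL_one]; rfl
  map_mul' g h := LinearIsometryEquiv.ext fun z => by
    rw [repEquiv_apply, actL_mul]; rfl

/-- Unfolding `rep`. [folklore] -/
theorem rep_apply (g : Πʳ i, [G i, B i]) (z : Space 𝓔) : rep hρ g z = actL hρ g z := rfl

/-- `(⊗′ρ)(g) (⊗ x_i) = ⊗ ρ_i(g_i) x_i`. [cite: Guichardet1972, App. A §A.4, p. 151 (PDF p. 88)] -/
@[simp] theorem rep_tp (g : Πʳ i, [G i, B i]) (x : RVec 𝓔) :
    rep hρ g (tp 𝓔 x) = tp 𝓔 (gact hρ g x) :=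
  actL_tp hρ g x

/-- Matrix coefficients of pure tensors are the (finite) products of the local ones. [folklore] -/
theorem inner_tp_rep_tp (g : Πʳ i, [G i, B i]) (x y : RVec 𝓔) :
    ⟪tp 𝓔 x, rep hρ g (tp 𝓔 y)⟫_ℂ = ∏ᶠ i, ⟪x i, ρ i (g i) (y i)⟫_ℂ := by
  rw [rep_tp, inner_tp_tp]; rfl

/-! ## §5 The S3-headline-shaped identities for `φ := ⊗ φ•`, `‖φ• i‖ = 1` -/


omit hρ in
/-- `hφ`-shape: `‖⊗ φ•‖ = 1`. [folklore] -/
theorem norm_tp_eq_one (φ : RVec 𝓔) (hφ : ∀ i, ‖φ i‖ = 1) : ‖tp 𝓔 φ‖ = 1 :=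
  norm_tp_of_norm_eq_one φ hφ

/-- If `ρ_i(k_i)` fixes `φ_i` for every `i`, then `(⊗′ρ)(k)` fixes `⊗ φ`. [folklore] -/
theorem rep_tp_eq_self_of_forall_apply_eq (φ : RVec 𝓔) {k : Πʳ i, [G i, B i]}
    (hk : ∀ i, ρ i (k i) (φ i) = φ i) : rep hρ k (tp 𝓔 φ) = tp 𝓔 φ := by
  rw [rep_tp]
  congr 1
  exact RVec.ext fun i => by rw [gact_apply, hk]

/-- `hK`-shape: an element `k` with `k_i ∈ B_i` for all `i` and `k_i = 1` on a finite set `T` (i.e. `k` in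
the box subgroup `K_T`) fixes `⊗ φ` as soon as `ρ_i(B_i)` fixes `φ_i` off `T`. (The package lemma
`rep_tp_eq_self_of_mem_boxSubgroup`, with the membership `k ∈ K_T` unfolded into its two defining
conditions.) [folklore] -/
theorem rep_tp_eq_self_of_box (φ : RVec 𝓔) {T : Finset ι}
    (hfix : ∀ i, i ∉ T → ∀ b ∈ B i, ρ i b (φ i) = φ i) {k : Πʳ i, [G i, B i]}
    (hkB : ∀ i, k i ∈ B i) (hkT : ∀ i ∈ T, k i = 1) : rep hρ k (tp 𝓔 φ) = tp 𝓔 φ :=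
  rep_tp_eq_self_of_forall_apply_eq hρ φ fun i => by
    by_cases hi : i ∈ T
    · rw [hkT i hi, map_one]; rfl
    · exact hfix i hi _ (hkB i)

/-- **Local matrix coefficients**: for a family of unit vectors `φ`, the matrix coefficient of `⊗ φ` at
the basic element `ι_i(g) = mulSingle B i g` is the local matrix coefficient `⟪φ_i, ρ_i(g) φ_i⟫` (all
other factors being `⟪φ_j, φ_j⟫ = 1`). [folklore] -/
theorem inner_tp_rep_mulSingle_tp [DecidableEq ι] (φ : RVec 𝓔) (hφ : ∀ i, ‖φ i‖ = 1) (i : ι)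
    (g : G i) :
    ⟪tp 𝓔 φ, rep hρ (RestrictedProduct.mulSingle B i g) (tp 𝓔 φ)⟫_ℂ = ⟪φ i, ρ i g (φ i)⟫_ℂ := by
  rw [inner_tp_rep_tp, finprod_eq_single _ i fun j hj => by
    rw [RestrictedProduct.coe_mulSingle_apply, Pi.mulSingle_eq_of_ne hj, map_one,
      LinearIsometryEquiv.coe_one, id_eq, inner_self_eq_norm_sq_to_K, hφ j]
    simp, RestrictedProduct.coe_mulSingle_apply, Pi.mulSingle_eq_same]

/-- `hM`-shape: for a family of unit vectors `φ` and `g` with `g_j = 1` off a finite set `S`, the matrix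
coefficient `⟪⊗φ, (⊗′ρ)(g) ⊗φ⟫` is the finite product `∏_{i ∈ S} ⟪φ_i, ρ_i(g_i) φ_i⟫` of local matrix
coefficients. [folklore] -/
theorem inner_tp_rep_tp_eq_prod (φ : RVec 𝓔) (hφ : ∀ i, ‖φ i‖ = 1) (S : Finset ι)
    (g : Πʳ i, [G i, B i]) (hg : ∀ j, j ∉ S → g j = 1) :
    ⟪tp 𝓔 φ, rep hρ g (tp 𝓔 φ)⟫_ℂ = ∏ i ∈ S, ⟪φ i, ρ i (g i) (φ i)⟫_ℂ := by
  rw [inner_tp_rep_tp]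
  refine finprod_eq_prod_of_mulSupport_subset _ fun j hj => Finset.mem_coe.2 ?_
  by_contra h
  refine hj ?_
  show ⟪φ j, ρ j (g j) (φ j)⟫_ℂ = 1
  rw [hg j h, map_one, LinearIsometryEquiv.coe_one, id_eq, inner_self_eq_norm_sq_to_K, hφ j]
  simp

/-- The action of a basic element `ι_i(g)` on a pure tensor changes only the `i`-th slot. [folklore] -/
theorem gact_mulSingle_update [DecidableEq ι] (x : RVec 𝓔) (i : ι) (g : G i) (v : H i) :
    gact hρ (RestrictedProduct.mulSingle B i g) (x.update i v) = x.update i (ρ i g v) := by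
  refine RVec.ext fun j => ?_
  rw [gact_apply, RestrictedProduct.coe_mulSingle_apply]
  by_cases hj : j = i
  · subst hj; rw [Pi.mulSingle_eq_same, RVec.update_apply_same, RVec.update_apply_same]
  · rw [Pi.mulSingle_eq_of_ne hj, RVec.update_apply_of_ne _ hj, RVec.update_apply_of_ne _ hj,
      map_one]; rfl

/-- `ι_i(g)` acts on `⊗ x` through the `i`-th slot. [folklore] -/
theorem rep_mulSingle_tp [DecidableEq ι] (x : RVec 𝓔) (i : ι) (g : G i) :
    rep hρ (RestrictedProduct.mulSingle B i g) (tp 𝓔 x) = slotₗ 𝓔 x i (ρ i g (x i)) := by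
  rw [rep_tp, slotₗ_apply, ← gact_mulSingle_update hρ x i g (x i), RVec.update_eq_self]

/-- **Slot intertwining** (`hVU`/`hVS`-shape): `ω(ι_i g) ∘ V_i = V_i ∘ ρ_i(g)` for the slot map
`V_i = slotₗ x i`. [folklore] -/
theorem rep_mulSingle_slotₗ [DecidableEq ι] (x : RVec 𝓔) (i : ι) (g : G i) (v : H i) :
    rep hρ (RestrictedProduct.mulSingle B i g) (slotₗ 𝓔 x i v) = slotₗ 𝓔 x i (ρ i g v) := by
  rw [slotₗ_apply, slotₗ_apply, rep_tp, gact_mulSingle_update]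

/-- **Slot intertwining for the isometric slot** `V_i = slot φ• i : H i →ₗᵢ[ℂ] ⊗′H` (the fields
`hVU`, `hVS` of `GenuineThetaInput`, given local data): `ω(ι_i g) (V_i v) = V_i (ρ_i(g) v)`, and
`V_i (φ•_i) = φ` (`hVUψ`, `hVSψ`). [folklore] -/
theorem rep_mulSingle_slot [DecidableEq ι] (φ : RVec 𝓔) (hφ : ∀ i, ‖φ i‖ = 1) (i : ι) (g : G i)
    (v : H i) :
    rep hρ (RestrictedProduct.mulSingle B i g) (slot 𝓔 φ hφ i v) = slot 𝓔 φ hφ i (ρ i g v) :=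
  rep_mulSingle_slotₗ hρ φ i g v

/-- `hiso`-shape: if `ρ_i(g)` acts on `φ•_i` by the scalar `c`, then `ω(ι_i g)` acts on `⊗ φ•` by
`c`. [folklore] -/
theorem rep_mulSingle_tp_of_smul [DecidableEq ι] (x : RVec 𝓔) (i : ι) (g : G i) (c : ℂ)
    (h : ρ i g (x i) = c • x i) :
    rep hρ (RestrictedProduct.mulSingle B i g) (tp 𝓔 x) = c • tp 𝓔 x := by
  rw [rep_mulSingle_tp, h, map_smul, slotₗ_apply, RVec.update_eq_self]

/-- `hloc`-shape: **strong continuity of `g ↦ ω(ι_i g) v` from local strong continuity.** [folklore] -/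
theorem continuous_rep_mulSingle [DecidableEq ι] (i : ι) [TopologicalSpace (G i)]
    (hcont : ∀ w : H i, Continuous fun g : G i => ρ i g w) (v : Space 𝓔) :
    Continuous fun g : G i => rep hρ (RestrictedProduct.mulSingle B i g) v := by
  -- the set of good vectors is a submodule containing the pure tensors, hence dense ...
  let M : Submodule ℂ (Space 𝓔) :=
    { carrier := {v | Continuous fun g : G i => rep hρ (RestrictedProduct.mulSingle B i g) v}
      add_mem' := fun {a b} ha hb => by
        simp only [Set.mem_setOf_eq, map_add] at ha hb ⊢
        exact ha.add hb
      zero_mem' := by simp only [Set.mem_setOf_eq, map_zero]; exact continuous_const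
      smul_mem' := fun c a ha => by
        simp only [Set.mem_setOf_eq, map_smul] at ha ⊢
        exact ha.const_smul c }
  have hM : Submodule.span ℂ (Set.range (tp 𝓔)) ≤ M := by
    refine Submodule.span_le.mpr ?_
    rintro _ ⟨x, rfl⟩
    show Continuous fun g : G i => rep hρ (RestrictedProduct.mulSingle B i g) (tp 𝓔 x)
    simp only [rep_mulSingle_tp]
    exact (continuous_slotₗ x i).comp (hcont (x i))
  have hdense : Dense (M : Set (Space 𝓔)) := dense_span_tp.mono hM
  -- ... and it is closed under uniform approximation, the operators being isometries.
  refine continuous_of_uniform_approx_of_continuous fun u hu => ?_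
  obtain ⟨ε, hε, hεu⟩ := Metric.mem_uniformity_dist.mp hu
  obtain ⟨w, hwM, hw⟩ := hdense.exists_dist_lt v hε
  refine ⟨fun g : G i => rep hρ (RestrictedProduct.mulSingle B i g) w, hwM, fun g => hεu ?_⟩
  rw [dist_eq_norm, ← map_sub, LinearIsometryEquiv.norm_map, ← dist_eq_norm]
  exact hw

end action

end Literature.Analysis.InnerProduct.RestrictedTensor
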